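import Summits.BirchSwinnertonDyer.BirchSwinnertonDyer.Theorems.KolyvaginRoadThreePTJumpAt
import Summits.BirchSwinnertonDyer.BirchSwinnertonDyer.Theorems.KolyvaginRoadThreePTSelmerComplementAtOfMiddleExact
import Summits.BirchSwinnertonDyer.BirchSwinnertonDyer.Theorems.KolyvaginRoadThreeZhangSupplyJumpStructures
import HarnessLib

/-!
# Route `KolyvaginRoadThree`, deciding crux `ZhangSharpFrameAtThreeHL` (item stmt-BirchSwinnertonDyer-19574):
# PT road, step (R) part 4 — the (J) binder `hjump` of S2-ENGINE's (Supply) from the two local Lagrangian inputs and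
# Milne I 4.10(b) FOR `E[3]` ALONE (cell `bsd-stepL`, ACCEL seat `bsd-stepL-koly3b` g10;
# `--supports stmt-BirchSwinnertonDyer-19574`, helper)

HONEST FRAMING. One theorem; 0 definitions, 0 named facts, 0 `sorry`; CONDITIONAL on the displayed hypotheses; closes
nothing (T7). PARTITION: O2@3 (B10) × A1 × crux 19574 × stub PT's consumer chain — proves-glue.

WHAT. Twin of koly3b part XVIII `ZhangSupply.hjump_of_localLagrangians` in which the named ∀-MODULE Poitou–Tate fact
`hPT : poitouTate_selmerStructure_duality K` is replaced by `hE3` = Milne *ADT* I Thm. 4.10(b) `Ker γ¹ ⊆ Im β¹` for the ONE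
module `E[3] = (E/K)[3]` and THE invariant maps `LocalInvariants.canonical K 3`, at every admissible `S ⊇ ∞` — the exact
conclusion shape of the owner's descent certificate `KolyvaginRoadThreePT.middleExact_canonical_of_descentData` (koly g19,
p555478; binders all discharged by g20 except the instance `K' = K(E[3])^{Syl₃}`). The proof is part XVIII's verbatim with
the family `inv := LocalInvariants.canonical K 3` (`canonical_isPerfect`, door-c6's `sumLocalTermEqZero_canonical`) and
the last line re-keyed (and part XVIII's two local-instance attributes turned into instance binders of the theorem:
`[Finite E[3]]`, `[∀ v, CompactSpace Γ_{K_v}]`, both `Prop`-valued): Howard's inclusion (ii) for the constructed pair `str false ≤ str true` at `S(T′)` is supplied by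
part 1 (`PTAt.selmerComplementAt_canonical_of_middleExact`) from `hE3`, and fed to part 3's `PTAt.hjump_of_lagrangian_at`.
So the (J) binder, hence (parts 5–6) the S2-ENGINE and the METHOD line's terminal certificate, depend on Poitou–Tate ONLY
through `hE3`.

References: [cite: WZhang2014, Lemma 8.2] [cite: McCallumLMS1991, Prop. 2.1 (p. 296)] [cite: MilneADT2006, Ch. I,
Cor. 2.3, Thm. 2.6, Cor. 3.4, Thm. 4.10] [cite: Howard2004HeegnerKolyvagin, Def. 2.1.10, Thm. 2.1.11]
[cite: PoonenRains2012, Prop. 4.10].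
-/

noncomputable section

open scoped Classical NumberField
open Function NumberField IsDedekindDomain Field WeierstrassCurve
open Literature.NumberTheory.EllipticCurves Literature.NumberTheory.EllipticCurves.ModularForms
open Literature.NumberTheory.GaloisRepresentations Literature.NumberTheory.GaloisRepresentations.DiscreteGaloisModule
  Literature.NumberTheory.GaloisCohomology
open Summit.BirchSwinnertonDyer.Rank1Residual.X11b.FiniteDuality
open Summit.BirchSwinnertonDyer.Rank1Residual.X11b.Relaxation
open Summit.BirchSwinnertonDyer.Rank1Residual.X11b
open Summit.BirchSwinnertonDyer.Rank1Residual.GaloisImage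
open Summit.BirchSwinnertonDyer.Rank1Residual.X11b.Three.Koly.Method2
open Summit.BirchSwinnertonDyer.Rank1Residual.X11b.Three.Koly.ZhangSupply

namespace Summit.BirchSwinnertonDyer.Rank1Residual.X11b.Three.Koly.PTAt

-- No local instances: the compactness of the local absolute Galois groups (cup products) and the finiteness of `E[3]`,
-- local instance ATTRIBUTES in part XVIII, are instance BINDERS of the theorem here (all `Prop`-valued).

variable (W : WeierstrassCurve ℚ) (K : Type) [Field K] [NumberField K] [W.IsElliptic] [W.IsGloballyMinimal]
  (ι : K →+* ℂ)

/-- **`hjump` from (Lag-ord) + (Lag-tr) modulo Milne I 4.10(b) for `E[3]` alone.** Binders: `hK` (the infinite place is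
complex); `hE3` — the basic middle exactness `Ker γ¹ ⊆ Im β¹` for `(E/K)[3]` and THE invariant maps at level `3`, at every
admissible `S ⊇ ∞` (replacing part XVIII's named ∀-module fact `hPT`); the places `plK` of the Kolyvagin primes (`hplK`);
the two families of genuine local conditions `Lord`, `Ltr` with isotropy ∕ count ∕ one-sided dictionary exactly as in
part XVIII. Conclusion: the binder `hjump` of `supply_signed_of_jump_bound` VERBATIM. [cite: WZhang2014, Lemma 8.2]
[cite: McCallumLMS1991, Prop. 2.1] [cite: MilneADT2006, Ch. I, Thm. 4.10, Cor. 3.4]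
[cite: Howard2004HeegnerKolyvagin, Thm. 2.1.11] -/
theorem hjump_of_localLagrangians_of_middleExact (hK : IsImaginaryQuadratic K)
    [Finite ((W.baseChange K).geomTorsion ((3 ^ 1 : ℕ) : ℤ))]
    [∀ v : Place K, CompactSpace (absoluteGaloisGroup (Place.Completion v))]
    -- Milne I 4.10(b) for `E[3]` over `K` and THE invariant maps at level `3`, at every admissible `S ⊇ ∞`
    (hE3 : ∀ S : Finset (Place K), (∀ w : InfinitePlace K, (Sum.inl w : Place K) ∈ S) →
      (∀ v : HeightOneSpectrum (𝓞 K), (Sum.inr v : Place K) ∉ S →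
        (((3 ^ 1 : ℕ) : ℕ) : 𝓞 K) ∉ v.asIdeal ∧
          GaloisRep.IsUnramifiedAt v ((W.baseChange K).torsionGaloisModule ((3 ^ 1 : ℕ) : ℤ))) →
      ∀ t : Π v : Place K, galoisCohomology (((W.baseChange K).torsionGaloisModule ((3 ^ 1 : ℕ) : ℤ)).toLocal v) 1,
        (∀ y : galoisCohomology (((W.baseChange K).torsionGaloisModule ((3 ^ 1 : ℕ) : ℤ)).tateDual (3 ^ 1 : ℕ)) 1,
          (∀ v : HeightOneSpectrum (𝓞 K), (Sum.inr v : Place K) ∉ S →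
            galoisCohomology.localization (((W.baseChange K).torsionGaloisModule ((3 ^ 1 : ℕ) : ℤ)).tateDual
              (3 ^ 1 : ℕ)) (Sum.inr v) 1 y ∈
              unramifiedSubgroup (GaloisRep.toLocal v
                (((W.baseChange K).torsionGaloisModule ((3 ^ 1 : ℕ) : ℤ)).tateDual (3 ^ 1 : ℕ))) 1) →
          ∑ v ∈ S, localTatePairingZMod ((W.baseChange K).torsionGaloisModule ((3 ^ 1 : ℕ) : ℤ)) (3 ^ 1 : ℕ) v
            (LocalInvariants.canonical K (3 ^ 1 : ℕ) v) (t v)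
            (galoisCohomology.localization (((W.baseChange K).torsionGaloisModule ((3 ^ 1 : ℕ) : ℤ)).tateDual
              (3 ^ 1 : ℕ)) v 1 y) = 0) →
        ∃ x : galoisCohomology ((W.baseChange K).torsionGaloisModule ((3 ^ 1 : ℕ) : ℤ)) 1,
          (∀ v : HeightOneSpectrum (𝓞 K), (Sum.inr v : Place K) ∉ S →
            galoisCohomology.localization ((W.baseChange K).torsionGaloisModule ((3 ^ 1 : ℕ) : ℤ)) (Sum.inr v) 1 x ∈
              unramifiedSubgroup (GaloisRep.toLocal v ((W.baseChange K).torsionGaloisModule ((3 ^ 1 : ℕ) : ℤ))) 1) ∧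
          ∀ v ∈ S, galoisCohomology.localization ((W.baseChange K).torsionGaloisModule ((3 ^ 1 : ℕ) : ℤ)) v 1 x = t v)
    (plK : {ℓ // Zhang2014.IsKolyvaginPrime (W.conductorNorm ℤ) W K 3 ℓ} → HeightOneSpectrum (𝓞 K))
    (hplK : ∀ ℓ, ((ℓ : ℕ) : 𝓞 K) ∈ (plK ℓ).asIdeal)
    (Lord Ltr : (v : HeightOneSpectrum (𝓞 K)) →
      AddSubgroup (galoisCohomology (((W.baseChange K).torsionGaloisModule ((3 ^ 1 : ℕ) : ℤ)).toLocal (Sum.inr v)) 1))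
    -- (Lag-ord): above good unipotent-admissible primes, `Lord v` is isotropic, of half size, inside the ordinary condition
    (hordIso : ∀ (q : {q // IsUAdmissiblePrime W K q}), FrobSqNeOneAt W 3 q.1 →
      ∀ (v : HeightOneSpectrum (𝓞 K)), ((q : ℕ) : 𝓞 K) ∈ v.asIdeal →
      ∀ (e : geomTorsion (W.baseChange K) ((3 ^ 1 : ℕ) : ℤ) → geomTorsion (W.baseChange K) ((3 ^ 1 : ℕ) : ℤ) →
          AlgebraicClosure K)
        (hμ : ∀ P Q, e P Q ^ (3 ^ 1) = 1) (hadd₁ : ∀ P₁ P₂ Q, e (P₁ + P₂) Q = e P₁ Q * e P₂ Q)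
        (hadd₂ : ∀ P Q₁ Q₂, e P (Q₁ + Q₂) = e P Q₁ * e P Q₂) (_halt : ∀ Q, e Q Q = 1)
        (_hnondeg : ∀ Q, (∀ P, e P Q = 1) → Q = 0)
        (hgal : ∀ (σ : absoluteGaloisGroup K) (P Q : geomTorsion (W.baseChange K) ((3 ^ 1 : ℕ) : ℤ)),
          σ • e P Q = e (σ • P) (σ • Q)),
      ∀ a ∈ Lord v, ∀ b ∈ Lord v,
        (weilContPairingLocal (W.baseChange K) (3 ^ 1) e hμ hadd₁ hadd₂ hgal (Sum.inr v)).cupProduct a b = 0)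
    (hordCard : ∀ (q : {q // IsUAdmissiblePrime W K q}), FrobSqNeOneAt W 3 q.1 →
      ∀ (v : HeightOneSpectrum (𝓞 K)), ((q : ℕ) : 𝓞 K) ∈ v.asIdeal →
      Nat.card (Lord v) * Nat.card (Lord v) =
        Nat.card (galoisCohomology (((W.baseChange K).torsionGaloisModule ((3 ^ 1 : ℕ) : ℤ)).toLocal (Sum.inr v)) 1))
    (hordIncl : ∀ (q : {q // IsUAdmissiblePrime W K q}), FrobSqNeOneAt W 3 q.1 →
      ∀ (v : HeightOneSpectrum (𝓞 K)), ((q : ℕ) : 𝓞 K) ∈ v.asIdeal → ∀ x : V3 W K,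
      galoisCohomology.localization ((W.baseChange K).torsionGaloisModule ((3 ^ 1 : ℕ) : ℤ)) (Sum.inr v) 1 x ∈
        Lord v → x ∈ (W.baseChange K).ordinaryLocalKer (v.adicCompletion K) ((3 ^ 1 : ℕ) : ℤ))
    -- (Lag-tr): at the place of every Kolyvagin prime, `Ltr` is isotropic, of half size, inside the transverse condition
    (htrIso : ∀ (ℓ' : {ℓ // Zhang2014.IsKolyvaginPrime (W.conductorNorm ℤ) W K 3 ℓ})
      (e : geomTorsion (W.baseChange K) ((3 ^ 1 : ℕ) : ℤ) → geomTorsion (W.baseChange K) ((3 ^ 1 : ℕ) : ℤ) →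
          AlgebraicClosure K)
        (hμ : ∀ P Q, e P Q ^ (3 ^ 1) = 1) (hadd₁ : ∀ P₁ P₂ Q, e (P₁ + P₂) Q = e P₁ Q * e P₂ Q)
        (hadd₂ : ∀ P Q₁ Q₂, e P (Q₁ + Q₂) = e P Q₁ * e P Q₂) (_halt : ∀ Q, e Q Q = 1)
        (_hnondeg : ∀ Q, (∀ P, e P Q = 1) → Q = 0)
        (hgal : ∀ (σ : absoluteGaloisGroup K) (P Q : geomTorsion (W.baseChange K) ((3 ^ 1 : ℕ) : ℤ)),
          σ • e P Q = e (σ • P) (σ • Q)),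
      ∀ a ∈ Ltr (plK ℓ'), ∀ b ∈ Ltr (plK ℓ'),
        (weilContPairingLocal (W.baseChange K) (3 ^ 1) e hμ hadd₁ hadd₂ hgal (Sum.inr (plK ℓ'))).cupProduct a b = 0)
    (htrCard : ∀ (ℓ' : {ℓ // Zhang2014.IsKolyvaginPrime (W.conductorNorm ℤ) W K 3 ℓ}),
      Nat.card (Ltr (plK ℓ')) * Nat.card (Ltr (plK ℓ')) =
        Nat.card (galoisCohomology (((W.baseChange K).torsionGaloisModule ((3 ^ 1 : ℕ) : ℤ)).toLocal
          (Sum.inr (plK ℓ'))) 1))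
    (htrIncl : ∀ (ℓ' : {ℓ // Zhang2014.IsKolyvaginPrime (W.conductorNorm ℤ) W K 3 ℓ}) (x : V3 W K),
      galoisCohomology.localization ((W.baseChange K).torsionGaloisModule ((3 ^ 1 : ℕ) : ℤ)) (Sum.inr (plK ℓ')) 1 x ∈
        Ltr (plK ℓ') → x ∈ transverseLocalKer W K ι ℓ' (plK ℓ')) :
    ∀ (n : Finset {q // IsUAdmissiblePrime W K q}), GoodLevel W K n → n.Nonempty →
      ∀ (ℓ : {ℓ // Zhang2014.IsKolyvaginPrime (W.conductorNorm ℤ) W K 3 ℓ}) (T : Finset _), ℓ ∉ T →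
      ∀ x₀ : V3 W K, ∃ x : V3 W K,
        ((∀ w : InfinitePlace K, x ∈ selmerLocalKer (W.baseChange K) w.Completion ((3 ^ 1 : ℕ) : ℤ)) ∧
          (∀ v : HeightOneSpectrum (𝓞 K), v ≠ plK ℓ → (∀ ℓ' ∈ T, plK ℓ' ≠ v) →
            ((∀ q ∈ n, ((q : ℕ) : 𝓞 K) ∉ v.asIdeal) →
              x ∈ selmerLocalKer (W.baseChange K) (v.adicCompletion K) ((3 ^ 1 : ℕ) : ℤ)) ∧
            (∀ q ∈ n, ((q : ℕ) : 𝓞 K) ∈ v.asIdeal →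
              x ∈ (W.baseChange K).ordinaryLocalKer (v.adicCompletion K) ((3 ^ 1 : ℕ) : ℤ))) ∧
          (∀ ℓ' ∈ T, x ∈ transverseLocalKer W K ι ℓ' (plK ℓ'))) ∧
        ∀ a : ℤ, x - a • x₀ ∉ (W.baseChange K).torsionLocalKer ((plK ℓ).adicCompletion K) ((3 ^ 1 : ℕ) : ℤ) := by
  intro n hg _hn ℓ T hℓT
  haveI : Fact (Nat.Prime 3) := ⟨Nat.prime_three⟩
  haveI : NeZero (3 ^ 1 : ℕ) := ⟨by norm_num⟩
  haveI : IsTotallyComplex K := hK.2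
  have hKc : ∀ w : InfinitePlace K, w.IsComplex := fun w ↦ IsTotallyComplex.isComplex w
  -- a Weil pairing on `E[3]` and the Poitou–Tate family at level `3`
  obtain ⟨e, hμ, hadd₁, hadd₂, halt, hnondeg, hgal⟩ :=
    exists_weilPairing_holds (W.baseChange K) (3 ^ 1) (by norm_num) (by norm_num)
  -- THE invariant maps at level `3`: perfect (Milne I Cor. 2.3) with the Poitou–Tate vanishing (tree theorems)
  have hperf : (LocalInvariants.canonical K (3 ^ 1)).IsPerfect := LocalInvariants.canonical_isPerfect
  have hsum : (LocalInvariants.canonical K (3 ^ 1)).SumLocalTermEqZero :=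
    Summit.BirchSwinnertonDyer.BirchSwinnertonDyer.Theorems.SchneiderFreeAdditiveX3.PoitouTateReduction.sumLocalTermEqZero_canonical
      (3 ^ 1)
  have hinj : ∀ v : HeightOneSpectrum (𝓞 K), Injective ((LocalInvariants.canonical K (3 ^ 1)) (Sum.inr v)) :=
    fun v ↦ (hperf v).1.1
  -- separation of the places: `λ ∉ plK(T)`, no Kolyvagin place lies above a prime of the level
  have hKK : ∀ ℓ' ∈ T, plK ℓ' ≠ plK ℓ := by
    intro ℓ' hℓ' h
    have hne : (ℓ' : ℕ) ≠ ℓ := fun h' ↦ hℓT (Subtype.ext h' ▸ hℓ')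
    have hcop : Nat.Coprime (ℓ : ℕ) (ℓ' : ℕ) := (Nat.coprime_primes ℓ.2.1 ℓ'.2.1).mpr (Ne.symm hne)
    exact not_mem_asIdeal_of_coprime K hcop (plK ℓ) (hplK ℓ) (h ▸ hplK ℓ')
  have hKU : ∀ (ℓ' : {ℓ // Zhang2014.IsKolyvaginPrime (W.conductorNorm ℤ) W K 3 ℓ})
      (q : {q // IsUAdmissiblePrime W K q}), ((q : ℕ) : 𝓞 K) ∉ (plK ℓ').asIdeal :=
    fun ℓ' q ↦ not_mem_of_kolyvagin_place W K q.2 ℓ'.2 (plK ℓ') (hplK ℓ')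
  -- the exceptional finite set `T'` of finite places: above `3`, bad, `λ`, `plK(T)`, above the level
  have h30 : (Ideal.span {((3 : ℕ) : 𝓞 K)} : Ideal (𝓞 K)) ≠ 0 := by
    rw [Ne, Ideal.zero_eq_bot, Ideal.span_singleton_eq_bot]
    exact_mod_cast Nat.prime_three.ne_zero
  have h3fin : {v : HeightOneSpectrum (𝓞 K) | ((3 : ℕ) : 𝓞 K) ∈ v.asIdeal}.Finite :=
    (Ideal.finite_factors h30).subset fun v hv ↦ (Ideal.dvd_span_singleton).mpr hv
  have hbadfin : {v : HeightOneSpectrum (𝓞 K) | ¬ (W.baseChange K).HasGoodReductionAt v}.Finite := by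
    have h := (W.baseChange K).eventually_hasGoodReductionAt
    rwa [Filter.eventually_cofinite] at h
  have hnfin : {v : HeightOneSpectrum (𝓞 K) | ∃ q ∈ n, ((q : ℕ) : 𝓞 K) ∈ v.asIdeal}.Finite := by
    have hq : ∀ q : {q // IsUAdmissiblePrime W K q},
        {v : HeightOneSpectrum (𝓞 K) | ((q : ℕ) : 𝓞 K) ∈ v.asIdeal}.Finite := by
      intro q
      have hq0 : (Ideal.span {((q : ℕ) : 𝓞 K)} : Ideal (𝓞 K)) ≠ 0 := by
        rw [Ne, Ideal.zero_eq_bot, Ideal.span_singleton_eq_bot]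
        exact_mod_cast q.2.1.ne_zero
      exact (Ideal.finite_factors hq0).subset fun v hv ↦ (Ideal.dvd_span_singleton).mpr hv
    refine ((n : Set {q // IsUAdmissiblePrime W K q}).toFinite.biUnion fun q _ ↦ hq q).subset ?_
    intro v hv
    obtain ⟨q, hqn, hqv⟩ := hv
    exact Set.mem_biUnion (Finset.mem_coe.mpr hqn) hqv
  set T' : Finset (HeightOneSpectrum (𝓞 K)) :=
    h3fin.toFinset ∪ hbadfin.toFinset ∪ {plK ℓ} ∪ T.image plK ∪ hnfin.toFinset with hT'
  have h3T' : ∀ v : HeightOneSpectrum (𝓞 K), ((3 : ℕ) : 𝓞 K) ∈ v.asIdeal → v ∈ T' := fun v hv ↦ by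
    apply Finset.mem_union_left; apply Finset.mem_union_left; apply Finset.mem_union_left
    apply Finset.mem_union_left
    exact h3fin.mem_toFinset.mpr hv
  have hbadT' : ∀ v : HeightOneSpectrum (𝓞 K), ¬ (W.baseChange K).HasGoodReductionAt v → v ∈ T' := fun v hv ↦ by
    apply Finset.mem_union_left; apply Finset.mem_union_left; apply Finset.mem_union_left
    apply Finset.mem_union_right
    exact hbadfin.mem_toFinset.mpr hv
  have hlamT' : plK ℓ ∈ T' := by
    apply Finset.mem_union_left; apply Finset.mem_union_left; apply Finset.mem_union_right
    exact Finset.mem_singleton_self _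
  have hTT' : ∀ ℓ' ∈ T, plK ℓ' ∈ T' := fun ℓ' hℓ' ↦ by
    apply Finset.mem_union_left; apply Finset.mem_union_right
    exact Finset.mem_image_of_mem plK hℓ'
  have hnT' : ∀ v : HeightOneSpectrum (𝓞 K), ∀ q ∈ n, ((q : ℕ) : 𝓞 K) ∈ v.asIdeal → v ∈ T' := fun v q hq hqv ↦ by
    apply Finset.mem_union_right
    exact hnfin.mem_toFinset.mpr ⟨q, hq, hqv⟩
  -- outside `T'`: `3 ∉ v`, good reduction, not `λ`, not a `T`-place, above no prime of the level
  have hout3 : ∀ v : HeightOneSpectrum (𝓞 K), v ∉ T' → ((3 : ℕ) : 𝓞 K) ∉ v.asIdeal := fun v hv h ↦ hv (h3T' v h)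
  have houtgood : ∀ v : HeightOneSpectrum (𝓞 K), v ∉ T' → (W.baseChange K).HasGoodReductionAt v := fun v hv ↦ by
    by_contra h
    exact hv (hbadT' v h)
  have houtlam : ∀ v : HeightOneSpectrum (𝓞 K), v ∉ T' → v ≠ plK ℓ := fun v hv h ↦ hv (h ▸ hlamT')
  have houtT : ∀ v : HeightOneSpectrum (𝓞 K), v ∉ T' → ¬ ∃ ℓ' ∈ T, plK ℓ' = v :=
    fun v hv ⟨ℓ', hℓ', h⟩ ↦ hv (h ▸ hTT' ℓ' hℓ')
  have houtn : ∀ v : HeightOneSpectrum (𝓞 K), v ∉ T' → ¬ ∃ q ∈ n, ((q : ℕ) : 𝓞 K) ∈ v.asIdeal :=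
    fun v hv ⟨q, hq, hqv⟩ ↦ hv (hnT' v q hq hqv)
  -- the two structures: `s = true` relaxed at `λ`, `s = false` strict at `λ`
  set 𝓚 : SelmerStructure ((W.baseChange K).torsionGaloisModule ((3 ^ 1 : ℕ) : ℤ)) :=
    (W.baseChange K).kummerSelmerStructure ((3 ^ 1 : ℕ) : ℤ) with h𝓚
  let str : Bool → SelmerStructure ((W.baseChange K).torsionGaloisModule ((3 ^ 1 : ℕ) : ℤ)) := fun s v ↦
    match v with
    | Sum.inl w => 𝓚 (Sum.inl w)
    | Sum.inr v =>
      if v = plK ℓ then (bif s then ⊤ else ⊥)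
      else if (∃ ℓ' ∈ T, plK ℓ' = v) then Ltr v
      else if (∃ q ∈ n, ((q : ℕ) : 𝓞 K) ∈ v.asIdeal) then Lord v
      else 𝓚 (Sum.inr v)
  have hstr_inl : ∀ s (w : InfinitePlace K), str s (Sum.inl w) = 𝓚 (Sum.inl w) := fun _ _ ↦ rfl
  have hstr_inr : ∀ s (v : HeightOneSpectrum (𝓞 K)), str s (Sum.inr v) =
      if v = plK ℓ then (bif s then ⊤ else ⊥)
      else if (∃ ℓ' ∈ T, plK ℓ' = v) then Ltr v
      else if (∃ q ∈ n, ((q : ℕ) : 𝓞 K) ∈ v.asIdeal) then Lord v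
      else 𝓚 (Sum.inr v) := fun _ _ ↦ rfl
  -- values at each kind of finite place
  have hstr_lam : ∀ s, str s (Sum.inr (plK ℓ)) = (bif s then ⊤ else ⊥) := fun s ↦ by
    rw [hstr_inr, if_pos rfl]
  have hstr_T : ∀ s, ∀ ℓ' ∈ T, str s (Sum.inr (plK ℓ')) = Ltr (plK ℓ') := fun s ℓ' hℓ' ↦ by
    rw [hstr_inr, if_neg (hKK ℓ' hℓ'), if_pos ⟨ℓ', hℓ', rfl⟩]
  have hstr_n : ∀ s (v : HeightOneSpectrum (𝓞 K)), v ≠ plK ℓ → (∀ ℓ' ∈ T, plK ℓ' ≠ v) →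
      ∀ q ∈ n, ((q : ℕ) : 𝓞 K) ∈ v.asIdeal → str s (Sum.inr v) = Lord v := fun s v hv hvT q hq hqv ↦ by
    rw [hstr_inr, if_neg hv, if_neg (fun ⟨ℓ', hℓ', h⟩ ↦ hvT ℓ' hℓ' h), if_pos ⟨q, hq, hqv⟩]
  have hstr_K : ∀ s (v : HeightOneSpectrum (𝓞 K)), v ≠ plK ℓ → (¬ ∃ ℓ' ∈ T, plK ℓ' = v) →
      (¬ ∃ q ∈ n, ((q : ℕ) : 𝓞 K) ∈ v.asIdeal) → str s (Sum.inr v) = 𝓚 (Sum.inr v) := fun s v hv hvT hvn ↦ by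
    rw [hstr_inr, if_neg hv, if_neg hvT, if_neg hvn]
  have hstr_out : ∀ s (v : HeightOneSpectrum (𝓞 K)), v ∉ T' → str s (Sum.inr v) = 𝓚 (Sum.inr v) :=
    fun s v hv ↦ hstr_K s v (houtlam v hv) (houtT v hv) (houtn v hv)
  -- the side conditions of part XIV
  have hS : ∀ v : HeightOneSpectrum (𝓞 K), v ∉ T' → (((3 ^ 1 : ℕ) : ℕ) : 𝓞 K) ∉ v.asIdeal ∧
      GaloisRep.IsUnramifiedAt v ((W.baseChange K).torsionGaloisModule (3 ^ 1 : ℕ)) := by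
    intro v hv
    have h3 : ((3 ^ 1 : ℕ) : 𝓞 K) ∉ v.asIdeal := by
      rw [pow_one]
      exact hout3 v hv
    refine ⟨h3, ?_⟩
    exact AcSelmer.isUnramifiedAt_torsionGaloisModule (W.baseChange K) (houtgood v hv)
      (n := ((3 ^ 1 : ℕ) : ℤ)) (by rw [Int.cast_natCast]; exact h3)
  have hunr : ∀ s, (str s).IsUnramifiedOutside (finSupport T') := by
    intro s
    refine ⟨fun w ↦ inl_mem_finSupport T' w, fun v hv ↦ ?_⟩
    rw [inr_mem_finSupport_iff] at hv
    rw [hstr_out s v hv, h𝓚]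
    exact KummerPT.kummerSelmerStructure_inr_eq_unramifiedSubgroup (W.baseChange K) 3 1
      (by exact_mod_cast hout3 v hv) (houtgood v hv)
  have heq : ∀ v : Place K, v ≠ Sum.inr (plK ℓ) → str false v = str true v := by
    intro v hv
    rcases v with w | v
    · rfl
    · have hv' : v ≠ plK ℓ := fun h ↦ hv (h ▸ rfl)
      rw [hstr_inr, hstr_inr, if_neg hv', if_neg hv']
  have hstrict : str false (Sum.inr (plK ℓ)) = ⊥ := hstr_lam false
  have hrelax : str true (Sum.inr (plK ℓ)) = ⊤ := hstr_lam true
  -- finiteness: `H¹_{str false} ⊆ H¹_{𝓚 relaxed on S(T')} = kummerOutside`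
  have hfin : Finite (str false).selmerGroup := by
    have hle : (str false).selmerGroup ≤ (KummerPT.kummerRelaxed (W.baseChange K) (3 ^ 1) (finSupport T')).selmerGroup := by
      intro x hx
      rw [SelmerStructure.mem_selmerGroup_iff] at hx ⊢
      intro v
      rcases v with w | v
      · rw [KummerPT.kummerRelaxed_of_mem _ _ _ (inl_mem_finSupport T' w)]
        exact AddSubgroup.mem_top _
      · by_cases hvT : v ∈ T'
        · rw [KummerPT.kummerRelaxed_of_mem _ _ _ ((inr_mem_finSupport_iff T' v).mpr hvT)]
          exact AddSubgroup.mem_top _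
        · rw [KummerPT.kummerRelaxed_of_not_mem _ _ _ (fun h ↦ hvT ((inr_mem_finSupport_iff T' v).mp h))]
          have h := hx (Sum.inr v)
          rw [hstr_out false v hvT, h𝓚] at h
          exact h
    haveI : Finite (KummerPT.kummerRelaxed (W.baseChange K) (3 ^ 1) (finSupport T')).selmerGroup := by
      rw [KummerPT.selmerGroup_kummerRelaxed]
      exact SelmerLevelBound.finite_kummerOutside (W.baseChange K) (3 ^ 1) (finSupport T')
    exact Finite.of_injective (AddSubgroup.inclusion hle) (AddSubgroup.inclusion_injective hle)
  -- the Lagrangian property off `λ`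
  have h31 : IsPrimePow (3 ^ 1 : ℕ) := Nat.prime_three.isPrimePow.pow one_ne_zero
  have hEP : ∀ v : HeightOneSpectrum (𝓞 K), localEulerPoincareCharacteristic (v.adicCompletion K) := fun v ↦ by
    haveI : CharZero (v.adicCompletion K) := charZero_of_injective_algebraMap (algebraMap K _).injective
    exact localEulerPoincareCharacteristic_holds (v.adicCompletion K)
  have hmaxK : ∀ v : Place K, annRight (invWeilPairing (W.baseChange K) (3 ^ 1 : ℕ) e hμ hadd₁ hadd₂ hgal
      (LocalInvariants.canonical K (3 ^ 1)) v) (𝓚 v) = 𝓚 v := fun v ↦ by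
    rw [h𝓚]
    exact KummerDuality.annRight_invWeilPairing_kummerSelmerStructure_eq (W.baseChange K) (3 ^ 1) e hμ hadd₁ hadd₂
      hgal halt hnondeg (LocalInvariants.canonical K (3 ^ 1)) hKc h31 hperf hEP v
  have hmax : ∀ v : Place K, v ≠ Sum.inr (plK ℓ) →
      annRight (invWeilPairing (W.baseChange K) (3 ^ 1 : ℕ) e hμ hadd₁ hadd₂ hgal (LocalInvariants.canonical K (3 ^ 1)) v)
        (str false v) = str false v := by
    intro v hv
    rcases v with w | v
    · rw [hstr_inl false w]
      exact hmaxK (Sum.inl w)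
    · have hv' : v ≠ plK ℓ := fun h ↦ hv (h ▸ rfl)
      by_cases hvT : ∃ ℓ' ∈ T, plK ℓ' = v
      · obtain ⟨ℓ', hℓ', rfl⟩ := hvT
        rw [hstr_T false ℓ' hℓ']
        exact annRight_invWeilPairing_eq_of_isotropic_of_card (W.baseChange K) (3 ^ 1) e hμ hadd₁ hadd₂ hgal hnondeg
          (LocalInvariants.canonical K (3 ^ 1)) (plK ℓ') (hinj _) (Ltr (plK ℓ'))
          (htrIso ℓ' e hμ hadd₁ hadd₂ halt hnondeg hgal) (htrCard ℓ')
      · by_cases hvn : ∃ q ∈ n, ((q : ℕ) : 𝓞 K) ∈ v.asIdeal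
        · obtain ⟨q, hq, hqv⟩ := hvn
          rw [hstr_n false v hv' (fun ℓ' hℓ' h ↦ hvT ⟨ℓ', hℓ', h⟩) q hq hqv]
          exact annRight_invWeilPairing_eq_of_isotropic_of_card (W.baseChange K) (3 ^ 1) e hμ hadd₁ hadd₂ hgal
            hnondeg (LocalInvariants.canonical K (3 ^ 1)) v (hinj v) (Lord v)
            (hordIso q (hg q hq) v hqv e hμ hadd₁ hadd₂ halt hnondeg hgal) (hordCard q (hg q hq) v hqv)
        · rw [hstr_K false v hv' hvT hvn]
          exact hmaxK (Sum.inr v)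
  -- `#H¹(K_λ, E[3]) = 81 > 9` (part XVII)
  have hw := nine_lt_natCard_galoisCohomology_one_toLocal_of_kolyvagin W K hK ℓ.2 (plK ℓ) (hplK ℓ)
  -- the dictionary `H¹_{str true} ⊆ G(n, ℓ, T)` (part XVI)
  have hincl := selmerGroup_subset_relaxedGroup W K ι plK n ℓ T (str true)
    (fun w ↦ by rw [hstr_inl true w, h𝓚, WeierstrassCurve.kummerSelmerStructure_apply]; exact le_rfl)
    (fun v hv hvT hvn ↦ by
      rw [hstr_K true v hv (fun ⟨ℓ', hℓ', h⟩ ↦ hvT ℓ' hℓ' h) (fun ⟨q, hq, hqv⟩ ↦ hvn q hq hqv), h𝓚,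
        WeierstrassCurve.kummerSelmerStructure_apply]
      exact le_rfl)
    (fun v hv hvT q hq hqv x hx ↦ by
      rw [hstr_n true v hv hvT q hq hqv] at hx
      exact hordIncl q (hg q hq) v hqv x hx)
    (fun ℓ' hℓ' x hx ↦ by
      rw [hstr_T true ℓ' hℓ'] at hx
      exact htrIncl ℓ' x hx)
  -- Howard (ii) for the pair `str false ≤ str true` at `S(T')`, from Milne I 4.10(b) for `E[3]` ALONE (part 1)
  have hM : ∀ m : (W.baseChange K).geomTorsion ((3 ^ 1 : ℕ) : ℤ), (3 ^ 1 : ℕ) • m = 0 :=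
    fun m ↦ AddSubgroup.torsionBy.nsmul m
  have hle : str false ≤ str true := fun v ↦ by
    by_cases hv : v = Sum.inr (plK ℓ)
    · rw [hv, hstrict]; exact bot_le
    · exact (heq v hv).le
  have hS' : ∀ v : HeightOneSpectrum (𝓞 K), (Sum.inr v : Place K) ∉ finSupport T' →
      (((3 ^ 1 : ℕ) : ℕ) : 𝓞 K) ∉ v.asIdeal ∧
        GaloisRep.IsUnramifiedAt v ((W.baseChange K).torsionGaloisModule (3 ^ 1 : ℕ)) :=
    fun v hv ↦ hS v (fun h ↦ hv ((inr_mem_finSupport_iff T' v).mpr h))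
  have hii := (PTAt.selmerComplementAt_canonical_of_middleExact (3 ^ 1) h31
    ((W.baseChange K).torsionGaloisModule ((3 ^ 1 : ℕ) : ℤ)) hM hE3 (finSupport T') hS' (str false) (str true) hle
    (hunr false) (hunr true)).2
  -- assemble (part 3, twin of part XIV)
  exact PTAt.hjump_of_lagrangian_at W K ι plK n ℓ T e hμ hadd₁ hadd₂ hgal hnondeg (LocalInvariants.canonical K (3 ^ 1))
    hperf hsum T' (hunr false) (hunr true) ⟨plK ℓ, hlamT'⟩ rfl heq hstrict hrelax hfin hmax hw hii hincl

end Summit.BirchSwinnertonDyer.Rank1Residual.X11b.Three.Koly.PTAt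

end
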